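import Summits.HodgeConjecture.HodgeConjecture.Theorems.R90S4TypeTwoTorusClasses      -- F3″a (this seat): `isConj_iff_isConj_of_conj_eq`, `charpoly_eq_mul_of_blockFrame`, `isRegularElt_of_blockFrame`, `isCompact_centralizer_of_blockFrame`; brings ★ F5b∕F3b∕F3a∕F1″
import Summits.HodgeConjecture.HodgeConjecture.Theorems.R90S4TypeTwoStableSetCount    -- ★ CARD A′ (K2E4-p14): `natCard_stableSet_eq_two` (the two-element stable set, (β) charpoly letter)
import Summits.HodgeConjecture.HodgeConjecture.Theorems.R90S4FiberIndexCount          -- ★ p864551 (B) (R90-C131-p01): `natCard_fiber_mul_index_eq_natCard_stableSet`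
import HarnessLib

/-!
# R90-TF · S4 «Ch. 13.1–2», (DICT)(2) file F3″b — THE TYPE-(2) MEMBER PACKAGE of the stable-transport dictionary, with its finer-count rows
# (Rogawski 1990, §3.5 Prop. 3.5.2 (c), §3.6 type (2) `T = T_K × E¹`, §4.3, §12.5 p. 182: `|𝔇(T∕F)| = 2`, `#{j : T_j = T″}·[N(T″):T″] = |Ω_F(T)| = 2`)

Cell `hodgecm-mathlib`, crux H413 (`stmt-HodgeConjecture-24833`, lane `--supports … --as helper`), route of record `HCCMUnconditional` (no route verbs; count-neutral).
Programme R90-TF, section S4 (base `R90-C131`), dealer K2E2-plan (g8), CARD A = F3″ (S4-R38 2026-09-05T02:21:29Z, head «=» S4-R41 (1)); seat K2E3-p12 (g11).  Type-(2) twin of ★ F3b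
`R90S4TypeOneMemberPackage` + ★ F5b `R90S4TypeOneFinerCount` §2 (`Fin 4 ↦ Fin 2`, `6 ↦ 2`).  THEOREMS ONLY (no `def`, no `instance`, no notation, no named-fact hypothesis, no `sorry`);
★-only imports; default heartbeats.

## THE MATHEMATICS
`G_v = Gqs L v = U(Φ₃)(L⁺_v)`, `v` NON-SPLIT; `C` (binder `Car`) a Cartan system with the CARTAN-ALL letters (2) `hZ` (members are regular centralisers), (4) `hcov` (every regular centraliser
is conjugate into a member), (5) `hirr` (members pairwise non-conjugate); `T_i = Z(γ₀) ∈ C` with `γ₀` of TYPE (2): `γ₀ P = P·[A 0; 0 u]`, `χ_A` irreducible over `L_w`.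
THE PACKAGE (the `hmem` input of ★ `isStableTransportDict_of_forall_member` at `T_i`, `k = 2 = |𝔇(T∕F)|`): ★ F1″ gives `γ₂ ∈ G_v` stably conjugate, NOT conjugate to `γ₀`, with
«`γ′ ∼_{st} γ₀ ⟺ γ′ ∼ γ₀ ∨ γ′ ∼ γ₂`»; take the two REALISERS `g₀ = 1`, `g₁ = y` (`y γ₀ y⁻¹ = γ₂`), `δ_j = g_j γ₀ g_j⁻¹`; by (CARTAN-ALL) `Z(δ_j) = x_j T_j x_j⁻¹` for a member
`T_j =: τ j`; with `y_j = x_j⁻¹ g_j` the TRANSPORT `e_j : T_i ≃ₜ* T_j`, `t ↦ y_j t y_j⁻¹`, is ★ `localStableCentralizerEquiv` (§4.3).  Clauses: (S) `e_j t ∼_{st} t`; (W) the tori are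
compact (★ F3″a `isCompact_centralizer_of_blockFrame`; compactness is a stable invariant), hence `≠ M`, and ★ `cartanWeight_eq_of_isStablyConjGAt` applies; (B) at a REGULAR `t ∈ T_i`:
`⟦e_j t⟧ = ⟦g_j t g_j⁻¹⟧`, and by ★ F3″a UNIFORMITY `isConj_iff_isConj_of_conj_eq` («`g t g⁻¹ ∼ t ⟺ g γ₀ g⁻¹ ∼ γ₀` for `t ∈ T_i^{reg}`») the two classes are distinct (`γ₂ ≁ γ₀`) and
exhaust the stable class of `t` (a stable conjugator `h` of `t` transports `γ₀ ↦ h γ₀ h⁻¹ ∈ G_v`, which is `∼ γ₀` or `∼ γ₂` by F1″; uniformity at the base `γ₀`, resp. `γ₂`) —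
«`|𝔇(T∕F)| = 2` classes, uniformly along `T^{reg}`» [Prop. 3.5.2 (c), §3.6 (2)].  FINER ROWS (p. 182): (T1″) reachability; (T2″) `#{j : τ j = k}·[N(k):k] = 2` = ★ (B)
`natCard_fiber_mul_index_eq_natCard_stableSet` + ★ A′ `natCard_stableSet_eq_two` (`= |Ω_F(T)|`); (T3″) a reachable `k` is `Z(γ′)` for a `γ′` of type (2) in the block-frame letter (α)
(`γ′ = y_j γ₀ y_j⁻¹`, frame `y_j P`, same `e, A, u`) — so the (DICT-Σ) assembler re-enters type (2) at `k` with no bridge.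

## CONTENTS
* §1 `exists_member_transport_of_conj` (one realiser ⇒ one member + transport), `bijOn_conjClasses_of_two_realisers` (the (B) engine at a regular point).
* §2 `exists_typeTwo_memberPackage` — `(τ, e)` with (S)(W)(B) and the exposed data `(g, x, δ)`, `g 0 = 1`, `¬ γ₀ ∼ δ 1`, `Z(δ_j) = x_j T_j x_j⁻¹`, `e_j t = y_j t y_j⁻¹`.
* §3 `exists_typeTwo_memberPackage_finer` — the package with (T1″)(T2″)(T3″) (head = S4-R38 (A) ∕ S4-R41 (1) bytes).

HONEST LABEL: HC_CM is proved only modulo the 7 printed citations (2 remaining named inputs: hLiu418 = stmt-HodgeConjecture-24832, h413 = stmt-HodgeConjecture-24833) until rung 0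
closes.  Input of ★ (B2-S) `isStableTransportDict_of_forall_member` ∕ ★ p864386 behind the OPEN (W-NP); discharges no named input.  REL ≠ ★ ≠ BUILT.

## References
* [Rogawski1990] J. D. Rogawski, *Automorphic Representations of Unitary Groups in Three Variables*, Ann. of Math. Stud. 123 (1990), §3.5 Prop. 3.5.2 (a)(c) p. 29, §3.6 pp. 28–31,
  §4.3 pp. 43–44, §12.5 p. 182.
* [Kottwitz1986] R. E. Kottwitz, *Stable trace formula: elliptic singular terms*, Math. Ann. 275 (1986), §7.
-/

set_option autoImplicit false
set_option linter.dupNamespace false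

open NumberField IsDedekindDomain Polynomial Matrix
open scoped MatrixGroups
open Literature.NumberTheory.Rogawski1990 Literature.NumberTheory.Automorphic Literature.NumberTheory.Automorphic.UnitaryGroup
open Literature.AlgebraicGeometry.ShimuraVarieties (unitaryGroup mem_unitaryGroup_iff)
open Summit.HodgeConjecture.HodgeConjecture.Cruxes.H413

namespace Summit.HodgeConjecture.HodgeConjecture.R90.S4

section TypeTwoPackage

variable (L : Type) [Field L] [NumberField L] [IsCMField L] (v : HeightOneSpectrum (𝓞 ↥(maximalRealSubfield L)))

variable {L v}

/-! ## §1 Transports and the two classes at every regular point -/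

/-- **ONE REALISER, ONE TRANSPORT.**  For `T_i = Z(γ₀) ∈ C` (`γ₀` regular), the covering letter `hcov` of ★ CARTAN-ALL and a realiser `g ∈ GL₃(L ⊗ L⁺_v)` of a class `δ = g γ₀ g⁻¹ ∈ G_v`:
`Z(δ) = x T x⁻¹` for a member `T ∈ C` and `x ∈ G_v`, and with `y = x⁻¹ g` the transport `e : T_i ≃ₜ* T`, `t ↦ y t y⁻¹` (★ `localStableCentralizerEquiv`, ★ F3b
`exists_centralizerEquiv_coe_eq_conj`), which is a stable conjugation pointwise. [cite: Rogawski1990, §4.3 pp. 43–44; §3.6 p. 31] -/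
theorem exists_member_transport_of_conj {Car : Finset (Subgroup (Gqs L v))} (i : ↥Car) {γ₀ δ : Gqs L v}
    (hreg₀ : IsRegularElt (γ₀.val : GL (Fin 3) (LocalRing L v))) (hi : (i : Subgroup (Gqs L v)) = Subgroup.centralizer ({γ₀} : Set (Gqs L v)))
    (hcov : ∀ γ : Gqs L v, IsRegularElt (γ.val : GL (Fin 3) (LocalRing L v)) →
      ∃ T ∈ Car, ∃ x : Gqs L v, Subgroup.centralizer ({γ} : Set (Gqs L v)) = T.map (MulAut.conj x).toMonoidHom)
    {g : GL (Fin 3) (LocalRing L v)} (hδ : δ.val = g * γ₀.val * g⁻¹) :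
    ∃ (T : ↥Car) (x : Gqs L v) (e : ↥(i : Subgroup (Gqs L v)) ≃ₜ* ↥((T : ↥Car) : Subgroup (Gqs L v))),
      Subgroup.centralizer ({δ} : Set (Gqs L v)) = ((T : ↥Car) : Subgroup (Gqs L v)).map (MulAut.conj x).toMonoidHom ∧
      (∀ t : ↥(i : Subgroup (Gqs L v)), ((e t : ↥((T : ↥Car) : Subgroup (Gqs L v))) : Gqs L v).val = (x.val⁻¹ * g) * (t : Gqs L v).val * (x.val⁻¹ * g)⁻¹) ∧
      (∀ t : ↥(i : Subgroup (Gqs L v)), IsStablyConjGAt L (R90.S4.splitFormGL L) v (t : Gqs L v) ((e t : ↥((T : ↥Car) : Subgroup (Gqs L v))) : Gqs L v)) := by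
  have hδreg : IsRegularElt (δ.val : GL (Fin 3) (LocalRing L v)) := by
    rw [hδ]; exact isRegularElt_of_isConj (isConj_iff.2 ⟨g, rfl⟩) hreg₀
  obtain ⟨T, hTC, x, hTx⟩ := hcov δ hδreg
  -- `δ′ = x⁻¹ δ x` has `Z(δ′) = T`, and `y = x⁻¹ g` conjugates `γ₀` to `δ′`
  have hZ' : Subgroup.centralizer ({x⁻¹ * δ * x} : Set (Gqs L v)) = T := by
    have h1 : x * (x⁻¹ * δ * x) * x⁻¹ = δ := by group
    have h2 : (Subgroup.centralizer ({x⁻¹ * δ * x} : Set (Gqs L v))).map (MulAut.conj x).toMonoidHom = T.map (MulAut.conj x).toMonoidHom := by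
      rw [← centralizer_singleton_conj_eq_map, h1, hTx]
    exact Subgroup.map_injective (MulAut.conj x).injective h2
  have hy : (x.val⁻¹ * g) * γ₀.val * (x.val⁻¹ * g)⁻¹ = (x⁻¹ * δ * x).val := by
    show (x.val⁻¹ * g) * γ₀.val * (x.val⁻¹ * g)⁻¹ = x.val⁻¹ * δ.val * x.val
    rw [hδ]; group
  obtain ⟨e, he⟩ := exists_centralizerEquiv_coe_eq_conj hreg₀ hy hi hZ'
  exact ⟨⟨T, hTC⟩, x, e, hTx, he, fun t => (isStablyConjGAt_iff_exists_conj_eq _ _).2 ⟨_, (he t).symm⟩⟩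

/-- **THE TWO CLASSES AT A REGULAR POINT OF A TYPE-(2) TORUS** — the (B)-clause engine.  Data: `γ₀ ∈ G_v` regular, `y` with `y γ₀ y⁻¹ = γ₂ ∈ G_v` NOT conjugate to `γ₀`, and the
dichotomy «`γ′ ∼_{st} γ₀ ⇒ γ′ ∼ γ₀ ∨ γ′ ∼ γ₂`» (★ F1″); a regular `t ∈ Z(γ₀)`; two elements `f 0, f 1 ∈ G_v` with `f j ∼ g_j t g_j⁻¹`, `g 0 = 1`, `g 1 = y`.  Then `j ↦ ⟦f j⟧` is a
BIJECTION from `Fin 2` onto the `G_v`-classes in the stable class of `t`: injective since `y t y⁻¹ ≁ t` (★ UNIFORMITY `isConj_iff_isConj_of_conj_eq` at the base `γ₀`), surjective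
since a stable conjugator `h` of `t` transports `γ₀ ↦ h γ₀ h⁻¹ ∈ G_v` (★ `exists_centralizerEquiv_coe_eq_conj` along `Z(t)`), which is `∼ γ₀` or `∼ γ₂`, whence `h t h⁻¹ ∼ t` or
`∼ y t y⁻¹` (uniformity at the base `γ₀`, resp. `γ₂`).  «`|𝔇(T∕F)| = 2` classes, uniformly along `T^{reg}`» [Prop. 3.5.2 (c), §3.6 (2)].
[cite: Rogawski1990, §3.5 Prop. 3.5.2 (a)(c) p. 29; §3.6 p. 31; §4.3 pp. 43–44] -/
theorem bijOn_conjClasses_of_two_realisers {γ₀ γ₂ : Gqs L v} (hreg₀ : IsRegularElt (γ₀.val : GL (Fin 3) (LocalRing L v))) {y : GL (Fin 3) (LocalRing L v)}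
    (hy : y * γ₀.val * y⁻¹ = γ₂.val) (hnc : ¬ IsConj γ₀ γ₂)
    (hall : ∀ γ' : Gqs L v, IsStablyConjGAt L (R90.S4.splitFormGL L) v γ₀ γ' → IsConj γ₀ γ' ∨ IsConj γ₂ γ')
    {t : Gqs L v} (ht₀ : t ∈ Subgroup.centralizer ({γ₀} : Set (Gqs L v))) (hreg : IsRegularElt (t.val : GL (Fin 3) (LocalRing L v)))
    {f : Fin 2 → Gqs L v} {g : Fin 2 → GL (Fin 3) (LocalRing L v)} (hg0 : g 0 = 1) (hg1 : g 1 = y)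
    (hf : ∀ j, ∃ a : Gqs L v, a.val = g j * t.val * (g j)⁻¹ ∧ IsConj (f j) a) :
    Set.BijOn (fun j : Fin 2 => ConjClasses.mk (f j)) Set.univ
      {c : ConjClasses (Gqs L v) | IsStablyConjGAt L (R90.S4.splitFormGL L) v t (Quotient.out c)} := by
  classical
  choose a haval hfa using hf
  have htγ : t * γ₀ = γ₀ * t := Subgroup.mem_centralizer_singleton_iff.1 ht₀
  have hcls : ∀ j, ConjClasses.mk (f j) = ConjClasses.mk (a j) := fun j => ConjClasses.mk_eq_mk_iff_isConj.2 (hfa j)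
  have ha0 : a 0 = t := Subtype.ext (by rw [haval 0, hg0, inv_one, mul_one, one_mul])
  have hast : ∀ j, IsStablyConjGAt L (R90.S4.splitFormGL L) v t (a j) := fun j => (isStablyConjGAt_iff_exists_conj_eq _ _).2 ⟨g j, (haval j).symm⟩
  have hfst : ∀ j, IsStablyConjGAt L (R90.S4.splitFormGL L) v t (f j) := fun j => IsConj.trans (hast j) (isStablyConjGAt_of_isConj (hfa j).symm)
  -- the two classes are distinct: uniformity at the base `γ₀` with the conjugator `y`
  have h01 : ConjClasses.mk (a 0) ≠ ConjClasses.mk (a 1) := by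
    intro h
    rw [ha0] at h
    have h1 : y * t.val * y⁻¹ = (a 1).val := by rw [haval 1, hg1]
    exact hnc ((isConj_iff_isConj_of_conj_eq hreg₀ hreg ht₀ hy h1).1 (ConjClasses.mk_eq_mk_iff_isConj.1 h))
  have hinj : ∀ j k : Fin 2, ConjClasses.mk (a j) = ConjClasses.mk (a k) → j = k :=
    Fin.forall_fin_two.2 ⟨Fin.forall_fin_two.2 ⟨fun _ => rfl, fun h => (h01 h).elim⟩, Fin.forall_fin_two.2 ⟨fun h => (h01 h.symm).elim, fun _ => rfl⟩⟩
  refine ⟨fun j _ => ?_, fun j _ k _ hjk => hinj j k (by rw [← hcls j, ← hcls k]; exact hjk), fun c hc => ?_⟩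
  · -- MapsTo: `t ∼_{st} f j ∼ out ⟦f j⟧`
    show IsStablyConjGAt L (R90.S4.splitFormGL L) v t (Quotient.out (ConjClasses.mk (f j)))
    exact IsConj.trans (hfst j) (mk_mem_stableIndexSet (f j))
  · -- SurjOn: transport `γ₀` along a stable conjugator `h` of `t`, then the dichotomy and uniformity at the base `γ₀` or `γ₂`
    set s : Gqs L v := Quotient.out c with hsdef
    obtain ⟨h, hh⟩ := (isStablyConjGAt_iff_exists_conj_eq t s).1 hc
    have hγ₀t : γ₀ ∈ Subgroup.centralizer ({t} : Set (Gqs L v)) := Subgroup.mem_centralizer_singleton_iff.2 htγ.symm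
    obtain ⟨e', he'⟩ := exists_centralizerEquiv_coe_eq_conj (γ₀ := t) (δ := s) hreg hh
      (A := Subgroup.centralizer ({t} : Set (Gqs L v))) (B := Subgroup.centralizer ({s} : Set (Gqs L v))) rfl rfl
    -- the transport `δ″ = h γ₀ h⁻¹ ∈ G_v` of `γ₀`
    set δ'' : Gqs L v := ((e' ⟨γ₀, hγ₀t⟩ : ↥(Subgroup.centralizer ({s} : Set (Gqs L v)))) : Gqs L v) with hδ''def
    have hδ'' : h * γ₀.val * h⁻¹ = δ''.val := (he' ⟨γ₀, hγ₀t⟩).symm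
    have hst'' : IsStablyConjGAt L (R90.S4.splitFormGL L) v γ₀ δ'' := (isStablyConjGAt_iff_exists_conj_eq _ _).2 ⟨h, hδ''⟩
    have hout : ∀ j, IsConj (a j) s → ConjClasses.mk (f j) = c := by
      intro j hj
      rw [hcls j, ConjClasses.mk_eq_mk_iff_isConj.2 hj, hsdef, ← ConjClasses.quotient_mk_eq_mk, Quotient.out_eq]
    rcases hall δ'' hst'' with h1 | h2
    · -- `h γ₀ h⁻¹ ∼ γ₀`: uniformity at `γ₀` gives `h t h⁻¹ ∼ t = a 0`
      refine ⟨0, Set.mem_univ _, hout 0 ?_⟩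
      rw [ha0]
      exact (isConj_iff_isConj_of_conj_eq hreg₀ hreg ht₀ hδ'' hh).2 h1
    · -- `h γ₀ h⁻¹ ∼ γ₂`: uniformity at `γ₂ = y γ₀ y⁻¹` (regular; `a 1 = y t y⁻¹ ∈ Z(γ₂)`) with the conjugator `h y⁻¹`
      refine ⟨1, Set.mem_univ _, hout 1 ?_⟩
      have hst₂ : IsStablyConjGAt L (R90.S4.splitFormGL L) v γ₀ γ₂ := (isStablyConjGAt_iff_exists_conj_eq _ _).2 ⟨y, hy⟩
      have hreg₂ : IsRegularElt (γ₂.val : GL (Fin 3) (LocalRing L v)) := isRegularElt_of_isConj hst₂ hreg₀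
      have hrega : IsRegularElt ((a 1).val : GL (Fin 3) (LocalRing L v)) := isRegularElt_of_isConj (hast 1) hreg
      have ha1Z : a 1 ∈ Subgroup.centralizer ({γ₂} : Set (Gqs L v)) := by
        refine Subgroup.mem_centralizer_singleton_iff.2 (Subtype.ext ?_)
        show (a 1).val * γ₂.val = γ₂.val * (a 1).val
        have htγ' : t.val * γ₀.val = γ₀.val * t.val := congrArg Subtype.val htγ
        rw [haval 1, hg1, ← hy]
        calc y * t.val * y⁻¹ * (y * γ₀.val * y⁻¹) = y * (t.val * γ₀.val) * y⁻¹ := by group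
          _ = y * (γ₀.val * t.val) * y⁻¹ := by rw [htγ']
          _ = y * γ₀.val * y⁻¹ * (y * t.val * y⁻¹) := by group
      have hc1 : h * y⁻¹ * γ₂.val * (h * y⁻¹)⁻¹ = δ''.val := by
        rw [← hδ'', ← hy]; group
      have hc2 : h * y⁻¹ * (a 1).val * (h * y⁻¹)⁻¹ = s.val := by
        rw [← hh, haval 1, hg1]; group
      exact (isConj_iff_isConj_of_conj_eq hreg₂ hrega ha1Z hc1 hc2).2 h2

/-! ## §2 The type-(2) member package -/

/-- **THE TYPE-(2) MEMBER PACKAGE** (`v` non-split).  Let `C` (binder `Car`) be a Cartan system of `G_v` with the covering letter (4) `hcov` of ★ CARTAN-ALL, and `T_i = Z(γ₀) ∈ C` with `γ₀` of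
type (2) (`γ₀ P = P·[A 0; 0 u]`, `χ_A` irreducible).  Then there are TWO targets `τ : Fin 2 → C` and transports `e j : T_i ≃ₜ* T_{τ j}` with: (S) `e j t ∼_{st} t`; (W)
`D_{T_{τ j}}(e j t) = D_{T_i}(t)` on `T_i^{reg}`; (B) for regular `t ∈ T_i`, `j ↦ ⟦e j t⟧` is a bijection from `Fin 2` onto `{c | t ∼_{st} out c}` («`|𝔇(T∕F)| = 2` classes in the
stable class, uniformly along `T^{reg}`»); and (DATA) realisers `g` with `g 0 = 1`, elements `x j ∈ G_v` and `δ j = g_j γ₀ g_j⁻¹ ∈ G_v` with `γ₀ ≁ δ 1`, `Z(δ j) = x_j T_{τ j} x_j⁻¹`,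
and the formula `e j t = y_j t y_j⁻¹`, `y_j = x_j⁻¹ g_j`.  The `hmem` input (with `k = μ i = 2`) of ★ `isStableTransportDict_of_forall_member` at a type-(2) member, up to the fibre
counts of `τ`. [cite: Rogawski1990, §3.5 Prop. 3.5.2 (a)(c) p. 29; §3.6 pp. 28–31; §4.3 pp. 43–44; §12.5 p. 182] [cite: Kottwitz1986, §7] -/
theorem exists_typeTwo_memberPackage (hns : ∀ w : PlacesOver L v, IsCMField.complexConj L • w.1 = w.1) {Car : Finset (Subgroup (Gqs L v))} (i : ↥Car)
    {γ₀ : Gqs L v} (P : GL (Fin 3) (LocalRing L v)) (e : Fin 2 ⊕ Fin 1 ≃ Fin 3) (A : Matrix (Fin 2) (Fin 2) (LocalRing L v)) (u : LocalRing L v)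
    (hP : γ₀.val.val * P.val = P.val * reindex e e (fromBlocks A 0 0 !![u])) (hA : Irreducible A.charpoly)
    (hi : (i : Subgroup (Gqs L v)) = Subgroup.centralizer ({γ₀} : Set (Gqs L v)))
    (hcov : ∀ γ : Gqs L v, IsRegularElt (γ.val : GL (Fin 3) (LocalRing L v)) →
      ∃ T ∈ Car, ∃ x : Gqs L v, Subgroup.centralizer ({γ} : Set (Gqs L v)) = T.map (MulAut.conj x).toMonoidHom) :
    ∃ (τ : Fin 2 → ↥Car) (e : ∀ j : Fin 2, ↥(i : Subgroup (Gqs L v)) ≃ₜ* ↥((τ j : ↥Car) : Subgroup (Gqs L v))),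
      (∀ (j : Fin 2) (t : ↥(i : Subgroup (Gqs L v))),
          IsStablyConjGAt L (R90.S4.splitFormGL L) v (t : Gqs L v) ((e j t : ↥((τ j : ↥Car) : Subgroup (Gqs L v))) : Gqs L v)) ∧
      (∀ (j : Fin 2) (t : ↥(i : Subgroup (Gqs L v))), IsRegularElt (((t : Gqs L v)).val : GL (Fin 3) (LocalRing L v)) →
          cartanWeight L v ((τ j : ↥Car) : Subgroup (Gqs L v)) (e j t) = cartanWeight L v (i : Subgroup (Gqs L v)) t) ∧
      (∀ t : ↥(i : Subgroup (Gqs L v)), IsRegularElt (((t : Gqs L v)).val : GL (Fin 3) (LocalRing L v)) →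
          Set.BijOn (fun j : Fin 2 => ConjClasses.mk ((e j t : ↥((τ j : ↥Car) : Subgroup (Gqs L v))) : Gqs L v)) Set.univ
            {c : ConjClasses (Gqs L v) | IsStablyConjGAt L (R90.S4.splitFormGL L) v (t : Gqs L v) (Quotient.out c)}) ∧
      (∃ (g : Fin 2 → GL (Fin 3) (LocalRing L v)) (x δ : Fin 2 → Gqs L v),
        g 0 = 1 ∧ (∀ j, (δ j).val = g j * γ₀.val * (g j)⁻¹) ∧ ¬ IsConj γ₀ (δ 1) ∧
        (∀ j, Subgroup.centralizer ({δ j} : Set (Gqs L v)) = ((τ j : ↥Car) : Subgroup (Gqs L v)).map (MulAut.conj (x j)).toMonoidHom) ∧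
        (∀ (j : Fin 2) (t : ↥(i : Subgroup (Gqs L v))),
          ((e j t : ↥((τ j : ↥Car) : Subgroup (Gqs L v))) : Gqs L v).val = ((x j).val⁻¹ * g j) * (t : Gqs L v).val * ((x j).val⁻¹ * g j)⁻¹)) := by
  classical
  have hreg₀ : IsRegularElt (γ₀.val : GL (Fin 3) (LocalRing L v)) := isRegularElt_of_blockFrame hns P e A u hP hA
  -- ★ F1″: the second class `γ₂` and the dichotomy at `γ₀`
  obtain ⟨γ₂, hst₂, hnc₂, hall⟩ := exists_isStablyConjGAt_iff_isConj_or_gqs L v hns γ₀ P e A u hP hA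
  obtain ⟨y, hy⟩ := (isStablyConjGAt_iff_exists_conj_eq γ₀ γ₂).1 hst₂
  -- the two realisers `g 0 = 1`, `g 1 = y` and the regular elements `δ 0 = γ₀`, `δ 1 = γ₂`
  set g : Fin 2 → GL (Fin 3) (LocalRing L v) := ![1, y] with hgdef
  set δ : Fin 2 → Gqs L v := ![γ₀, γ₂] with hδdef
  have hg0 : g 0 = 1 := rfl
  have hg1 : g 1 = y := rfl
  have hδ0 : δ 0 = γ₀ := rfl
  have hδ1 : δ 1 = γ₂ := rfl
  have hδval : ∀ j, (δ j).val = g j * γ₀.val * (g j)⁻¹ := by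
    refine Fin.forall_fin_two.2 ⟨?_, ?_⟩
    · rw [hδ0, hg0, inv_one, mul_one, one_mul]
    · rw [hδ1, hg1, hy]
  -- the members `τ j`, conjugators `x j` and transports `e j`
  choose τ x eT hTx he hS using fun j => exists_member_transport_of_conj i hreg₀ hi hcov (hδval j)
  -- compactness: `T_i` and the `T_{τ j}` are compact, hence `≠ M`
  have hZc : IsCompact ((Subgroup.centralizer ({γ₀} : Set (Gqs L v))) : Set (Gqs L v)) := isCompact_centralizer_of_blockFrame hns P e A u hP hA
  have hic : IsCompact (((i : Subgroup (Gqs L v))) : Set (Gqs L v)) := by rw [hi]; exact hZc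
  have hγ₀i : γ₀ ∈ (i : Subgroup (Gqs L v)) := by rw [hi]; exact Subgroup.mem_centralizer_singleton_iff.2 rfl
  have hτc : ∀ j, IsCompact ((((τ j : ↥Car) : Subgroup (Gqs L v))) : Set (Gqs L v)) := by
    intro j
    have hreg' : IsRegularElt ((((eT j ⟨γ₀, hγ₀i⟩ : ↥((τ j : ↥Car) : Subgroup (Gqs L v))) : Gqs L v)).val : GL (Fin 3) (LocalRing L v)) :=
      isRegularElt_of_isConj (hS j ⟨γ₀, hγ₀i⟩) hreg₀
    have hZe : Subgroup.centralizer ({((eT j ⟨γ₀, hγ₀i⟩ : ↥((τ j : ↥Car) : Subgroup (Gqs L v))) : Gqs L v)} : Set (Gqs L v)) = ((τ j : ↥Car) : Subgroup (Gqs L v)) := by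
      -- `Z(e j γ₀) = Z(x_j⁻¹ δ_j x_j) = x_j⁻¹ Z(δ_j) x_j = T_j`
      have h1 : ((eT j ⟨γ₀, hγ₀i⟩ : ↥((τ j : ↥Car) : Subgroup (Gqs L v))) : Gqs L v) = (x j)⁻¹ * δ j * x j := by
        refine Subtype.ext ?_
        show ((eT j ⟨γ₀, hγ₀i⟩ : ↥((τ j : ↥Car) : Subgroup (Gqs L v))) : Gqs L v).val = (x j).val⁻¹ * (δ j).val * (x j).val
        rw [he j, hδval]; group
      have h2 : x j * ((x j)⁻¹ * δ j * x j) * (x j)⁻¹ = δ j := by group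
      have h3 : (Subgroup.centralizer ({(x j)⁻¹ * δ j * x j} : Set (Gqs L v))).map (MulAut.conj (x j)).toMonoidHom =
          (((τ j : ↥Car) : Subgroup (Gqs L v))).map (MulAut.conj (x j)).toMonoidHom := by
        rw [← centralizer_singleton_conj_eq_map, h2, hTx]
      rw [h1]
      exact Subgroup.map_injective (MulAut.conj (x j)).injective h3
    have hiff := isCompact_centralizer_iff_of_isStablyConjGAt (Φ := R90.S4.splitFormGL L) hreg₀ (hS j ⟨γ₀, hγ₀i⟩)
    rw [← hZe]; exact hiff.1 hZc
  have hiM : (i : Subgroup (Gqs L v)) ≠ (cmBorelTriple L 3 v).M := by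
    intro h; rw [h] at hic; exact F0P3cStCharTSCartanFields.not_isCompact_cmTorus L v hic
  have hτM : ∀ j, (((τ j : ↥Car) : Subgroup (Gqs L v))) ≠ (cmBorelTriple L 3 v).M := by
    intro j h; have h' := hτc j; rw [h] at h'; exact F0P3cStCharTSCartanFields.not_isCompact_cmTorus L v h'
  have hnc₁ : ¬ IsConj γ₀ (δ 1) := by rw [hδ1]; exact hnc₂
  refine ⟨τ, eT, hS, fun j t _ => cartanWeight_eq_of_isStablyConjGAt hiM (hτM j) (hS j t), fun t hreg => ?_, ⟨g, x, δ, hg0, hδval, hnc₁, hTx, he⟩⟩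
  -- (B) at a regular `t ∈ T_i`: the realised family `x_j (e j t) x_j⁻¹ = g_j t g_j⁻¹`
  have ht₀ : (t : Gqs L v) ∈ Subgroup.centralizer ({γ₀} : Set (Gqs L v)) := by rw [← hi]; exact t.2
  refine bijOn_conjClasses_of_two_realisers hreg₀ hy hnc₂ (fun γ' h => (hall γ').1 h) ht₀ hreg hg0 hg1 fun j =>
    ⟨x j * ((eT j t : ↥((τ j : ↥Car) : Subgroup (Gqs L v))) : Gqs L v) * (x j)⁻¹, ?_, isConj_iff.2 ⟨x j, rfl⟩⟩
  show (x j).val * ((eT j t : ↥((τ j : ↥Car) : Subgroup (Gqs L v))) : Gqs L v).val * (x j).val⁻¹ = g j * (t : Gqs L v).val * (g j)⁻¹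
  rw [he j t]; group

/-! ## §3 The type-(2) package with its finer-count rows -/

/-- **THE TYPE-(2) MEMBER PACKAGE WITH THE FINER-COUNT ROWS** (`v` non-split; Cartan system with CARTAN-ALL letters (2) `hZ`, (4) `hcov`, (5) `hirr`; `T_i = Z(γ₀)` of type (2) in the
block-frame letter `γ₀ P = P·[A 0; 0 u]`, `χ_A` irreducible).  The §1 package `(τ, e)` with (S)(W)(B), and moreover: (T1″) REACHABILITY — `(∃ j, τ j = k) ↔` some regular `t ∈ T_i`
is stably conjugate to some `t″ ∈ k`; (T2″) THE COUNT — `#{j : τ j = k}·[N(k):k] = 2` for every reachable `k` (★ (B) `natCard_fiber_mul_index_eq_natCard_stableSet` + ★ A′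
`natCard_stableSet_eq_two`: «`= |Ω_F(T)| = 2`», p. 182); (T3″) a reachable `k` is `Z(γ′)` for a `γ′` of type (2) in the block-frame letter (α) (frame `y_j P`, same block `A`, corner `u`).
[cite: Rogawski1990, §12.5 p. 182; §3.6 pp. 28–31; §3.5 Prop. 3.5.2 (c) p. 29] [cite: Kottwitz1986, §7] -/
theorem exists_typeTwo_memberPackage_finer (hns : ∀ w : PlacesOver L v, IsCMField.complexConj L • w.1 = w.1) {Car : Finset (Subgroup (Gqs L v))} (i : ↥Car)
    {γ₀ : Gqs L v} (P : GL (Fin 3) (LocalRing L v)) (e : Fin 2 ⊕ Fin 1 ≃ Fin 3) (A : Matrix (Fin 2) (Fin 2) (LocalRing L v)) (u : LocalRing L v)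
    (hP : γ₀.val.val * P.val = P.val * reindex e e (fromBlocks A 0 0 !![u])) (hA : Irreducible A.charpoly)
    (hi : (i : Subgroup (Gqs L v)) = Subgroup.centralizer ({γ₀} : Set (Gqs L v)))
    (hZ : ∀ T ∈ Car, ∃ γ : Gqs L v, IsRegularElt (γ.val : GL (Fin 3) (LocalRing L v)) ∧ T = Subgroup.centralizer ({γ} : Set (Gqs L v)))
    (hcov : ∀ γ : Gqs L v, IsRegularElt (γ.val : GL (Fin 3) (LocalRing L v)) →
      ∃ T ∈ Car, ∃ x : Gqs L v, Subgroup.centralizer ({γ} : Set (Gqs L v)) = T.map (MulAut.conj x).toMonoidHom)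
    (hirr : ∀ T ∈ Car, ∀ T' ∈ Car, (∃ x : Gqs L v, T.map (MulAut.conj x).toMonoidHom = T') → T = T') :
    ∃ (τ : Fin 2 → ↥Car) (e : ∀ j : Fin 2, ↥(i : Subgroup (Gqs L v)) ≃ₜ* ↥((τ j : ↥Car) : Subgroup (Gqs L v))),
      (∀ (j : Fin 2) (t : ↥(i : Subgroup (Gqs L v))),
          IsStablyConjGAt L (R90.S4.splitFormGL L) v (t : Gqs L v) ((e j t : ↥((τ j : ↥Car) : Subgroup (Gqs L v))) : Gqs L v)) ∧
      (∀ (j : Fin 2) (t : ↥(i : Subgroup (Gqs L v))), IsRegularElt (((t : Gqs L v)).val : GL (Fin 3) (LocalRing L v)) →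
          cartanWeight L v ((τ j : ↥Car) : Subgroup (Gqs L v)) (e j t) = cartanWeight L v (i : Subgroup (Gqs L v)) t) ∧
      (∀ t : ↥(i : Subgroup (Gqs L v)), IsRegularElt (((t : Gqs L v)).val : GL (Fin 3) (LocalRing L v)) →
          Set.BijOn (fun j : Fin 2 => ConjClasses.mk ((e j t : ↥((τ j : ↥Car) : Subgroup (Gqs L v))) : Gqs L v)) Set.univ
            {c : ConjClasses (Gqs L v) | IsStablyConjGAt L (R90.S4.splitFormGL L) v (t : Gqs L v) (Quotient.out c)}) ∧
      (∀ k : ↥Car, (∃ j, τ j = k) ↔ ∃ (t : ↥(i : Subgroup (Gqs L v))) (t'' : ↥(k : Subgroup (Gqs L v))),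
          IsRegularElt (((t : Gqs L v)).val : GL (Fin 3) (LocalRing L v)) ∧ IsStablyConjGAt L (R90.S4.splitFormGL L) v (t : Gqs L v) (t'' : Gqs L v)) ∧
      (∀ k : ↥Car, (∃ j, τ j = k) →
          Nat.card {j : Fin 2 // τ j = k} * (((k : Subgroup (Gqs L v)).subgroupOf (Subgroup.normalizer ((k : Subgroup (Gqs L v)) : Set (Gqs L v)))).index) = 2) ∧
      (∀ k : ↥Car, (∃ j, τ j = k) → ∃ (γ' : Gqs L v) (P' : GL (Fin 3) (LocalRing L v)) (e' : Fin 2 ⊕ Fin 1 ≃ Fin 3) (A' : Matrix (Fin 2) (Fin 2) (LocalRing L v))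
          (u' : LocalRing L v), γ'.val.val * P'.val = P'.val * reindex e' e' (fromBlocks A' 0 0 !![u']) ∧ Irreducible A'.charpoly ∧
          (k : Subgroup (Gqs L v)) = Subgroup.centralizer ({γ'} : Set (Gqs L v))) := by
  classical
  obtain ⟨τ, eT, hS, hW, hB, g, x, δ, -, -, -, -, he⟩ := exists_typeTwo_memberPackage hns i P e A u hP hA hi hcov
  obtain ⟨w⟩ := (inferInstance : Nonempty (PlacesOver L v))
  letI : Field (LocalRing L v) := (LocalRing.isField_of_smul_eq (IsCMField.complexConj L) (IsCMField.complexConj_ne_one L) w (hns w)).toField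
  have hreg₀ : IsRegularElt (γ₀.val : GL (Fin 3) (LocalRing L v)) := isRegularElt_of_blockFrame hns P e A u hP hA
  have hchar : γ₀.val.val.charpoly = A.charpoly * (X - C u) := charpoly_eq_mul_of_blockFrame P e A u hP
  have hq2 : A.charpoly.natDegree = 2 := by rw [Matrix.charpoly_natDegree_eq_dim, Fintype.card_fin]
  have hγ₀i : γ₀ ∈ (i : Subgroup (Gqs L v)) := by rw [hi]; exact Subgroup.mem_centralizer_singleton_iff.2 rfl
  -- the regular base point `γ₀ ∈ T_i`
  set t₀ : ↥(i : Subgroup (Gqs L v)) := ⟨γ₀, hγ₀i⟩ with ht₀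
  have hpin : ∀ (t : ↥(i : Subgroup (Gqs L v))), IsRegularElt (((t : Gqs L v)).val : GL (Fin 3) (LocalRing L v)) →
      ∀ (k : ↥Car) (s : Gqs L v), s ∈ (k : Subgroup (Gqs L v)) → IsStablyConjGAt L (R90.S4.splitFormGL L) v (t : Gqs L v) s →
      ∀ j, ConjClasses.mk ((eT j t : ↥((τ j : ↥Car) : Subgroup (Gqs L v))) : Gqs L v) = ConjClasses.mk s → τ j = k := by
    intro t ht k s hs hst j hj
    exact Subtype.ext (member_eq_of_isConj hZ hirr (τ j).2 k.2 (eT j t).2 hs (isRegularElt_of_isConj (hS j t) ht) (isRegularElt_of_isConj hst ht)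
      (ConjClasses.mk_eq_mk_iff_isConj.1 hj))
  have hZe : ∀ j, Subgroup.centralizer ({((eT j t₀ : ↥((τ j : ↥Car) : Subgroup (Gqs L v))) : Gqs L v)} : Set (Gqs L v)) = ((τ j : ↥Car) : Subgroup (Gqs L v)) :=
    fun j => centralizer_eq_of_mem_member hZ (τ j).2 (eT j t₀).2 (isRegularElt_of_isConj (hS j t₀) hreg₀)
  have hT3 : ∀ k : ↥Car, (∃ j, τ j = k) → ∃ (γ' : Gqs L v) (P' : GL (Fin 3) (LocalRing L v)) (e' : Fin 2 ⊕ Fin 1 ≃ Fin 3)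
      (A' : Matrix (Fin 2) (Fin 2) (LocalRing L v)) (u' : LocalRing L v), γ'.val.val * P'.val = P'.val * reindex e' e' (fromBlocks A' 0 0 !![u']) ∧
      Irreducible A'.charpoly ∧ (k : Subgroup (Gqs L v)) = Subgroup.centralizer ({γ'} : Set (Gqs L v)) := by
    rintro k ⟨j, rfl⟩
    refine ⟨(eT j t₀ : Gqs L v), ((x j).val⁻¹ * g j) * P, e, A, u, ?_, hA, (hZe j).symm⟩
    rw [he j t₀]
    have e1 : (x j).val⁻¹ * g j * (t₀ : Gqs L v).val * ((x j).val⁻¹ * g j)⁻¹ * ((x j).val⁻¹ * g j * P) = (x j).val⁻¹ * g j * (γ₀.val * P) := by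
      show (x j).val⁻¹ * g j * γ₀.val * ((x j).val⁻¹ * g j)⁻¹ * ((x j).val⁻¹ * g j * P) = (x j).val⁻¹ * g j * (γ₀.val * P)
      group
    have e2 := congrArg (fun z : GL (Fin 3) (LocalRing L v) => z.val) e1
    simp only [Units.val_mul] at e2 ⊢
    rw [e2, hP]
    simp only [Matrix.mul_assoc]
  refine ⟨τ, eT, hS, hW, hB, fun k => ⟨?_, ?_⟩, fun k hk => ?_, hT3⟩
  · rintro ⟨j, rfl⟩
    exact ⟨t₀, ⟨(eT j t₀ : Gqs L v), (eT j t₀).2⟩, hreg₀, hS j t₀⟩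
  · rintro ⟨t, t'', ht, hst⟩
    have hc : ConjClasses.mk (t'' : Gqs L v) ∈ {c : ConjClasses (Gqs L v) | IsStablyConjGAt L (R90.S4.splitFormGL L) v (t : Gqs L v) (Quotient.out c)} :=
      IsConj.trans hst (mk_mem_stableIndexSet (t'' : Gqs L v))
    obtain ⟨j, -, hj⟩ := (hB t ht).2.2 hc
    exact ⟨j, hpin t ht k (t'' : Gqs L v) t''.2 hst j hj⟩
  · -- (T2″): the generic double count ★ (B) and the two-element stable set ★ A′
    obtain ⟨j₀, hj₀⟩ := hk
    have hcount := natCard_fiber_mul_index_eq_natCard_stableSet hZ hirr hreg₀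
      (a := fun j => ((eT j t₀ : ↥((τ j : ↥Car) : Subgroup (Gqs L v))) : Gqs L v)) (T := fun j => ((τ j : ↥Car) : Subgroup (Gqs L v)))
      (fun j => (τ j).2) (fun j => (eT j t₀).2) (fun j => hS j t₀)
      (fun j j' h => (hB t₀ hreg₀).2.1 (Set.mem_univ j) (Set.mem_univ j') h)
      (fun s hs => by
        obtain ⟨j, -, hj⟩ := (hB t₀ hreg₀).2.2 (show ConjClasses.mk s ∈ {c : ConjClasses (Gqs L v) |
            IsStablyConjGAt L (R90.S4.splitFormGL L) v (t₀ : Gqs L v) (Quotient.out c)} from IsConj.trans hs (mk_mem_stableIndexSet s))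
        exact ⟨j, hj⟩)
      k.2
    have hs₁ : ((eT j₀ t₀ : ↥((τ j₀ : ↥Car) : Subgroup (Gqs L v))) : Gqs L v).val.val.charpoly = A.charpoly * (X - C u) := by
      rw [charpoly_eq_of_isStablyConjGAt (hS j₀ t₀)]; exact hchar
    have hK : Subgroup.centralizer ({((eT j₀ t₀ : ↥((τ j₀ : ↥Car) : Subgroup (Gqs L v))) : Gqs L v)} : Set (Gqs L v)) = (k : Subgroup (Gqs L v)) := by
      rw [hZe j₀, hj₀]
    have h2 := natCard_stableSet_eq_two hns A.charpoly u hA hq2 hs₁ hK hchar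
    have hcard : Nat.card {j : Fin 2 // τ j = k} = Nat.card {j : Fin 2 // ((τ j : ↥Car) : Subgroup (Gqs L v)) = (k : Subgroup (Gqs L v))} :=
      Nat.card_congr (Equiv.subtypeEquivRight fun j => Subtype.ext_iff)
    rw [hcard, hcount, h2]

end TypeTwoPackage

end Summit.HodgeConjecture.HodgeConjecture.R90.S4
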